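import Summits.QuantumFields.BalabanUV.T4Continuum.Support.RegionGaugeFixedVectorTop
import Summits.QuantumFields.BalabanUV.T4Continuum.Support.RegionScalarCompression
import Summits.QuantumFields.BalabanUV.T4Continuum.Support.DirichletDirectionalBesov
import Summits.QuantumFields.BalabanUV.T4Continuum.Support.CovariantBlockAveraging

/-!
# T⁴ programme, spine node NE2 (U1a), sub-row Δ1 «NE2⁰-Dirichlet» — NORM AND PAIRING TOOLS for the slab no-go: `‖gradR f‖² ≤ 4d·n²‖f‖²`,
# `‖avgR‖², ‖avgRᴴ‖² ≤ n^{−d}`, `‖gradR·R(Ω₀)u‖ ≤ 2√d·n·‖u‖` (any region), and the abstract two-level PAIRING identity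
# `⟨D′v′, (D′⁻¹J − JD⁻¹)(Ds)⟩ = ⟨v′, J(Ds)⟩ − ⟨D′v′, Js⟩` with its energy inequality

NE2 formalisation swarm `b2b-balaban-t4-ne2-formalise-*`, LEAF PROVER 02 (gen 7), supplier item «Δ1-VEC-W3̃-SLAB-NOGO» (owner ruling R29
successor item (iii), NEGATIVE side), tools file (generic; no slab object appears).  Consumed by `Support/DirichletStarSlabLayerEnergy` and
`Support/DirichletStarRenormSlabNoGo`.

 * §1 norms (any region `S`, level `n`): `nsq_restrict_le'`, `nsq_GradOp_mulVec_le`, **`nsq_gradR_le`**, `nsq_avgR_le`, `nsq_avgR_conjTranspose_le`,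
   `sqrt_nsq_mass_le` (`‖a n^d·avgRᴴavgR A‖ ≤ a‖A‖`), `sqrt_nsq_gradR_gaugeR_le`;
 * §2 pairing (any finite index types; Hermitian invertible `D′`, invertible `D`, any `J`): `sqrt_nsq_mulVec_le`, **`pairing_identity`**,
   **`energy_le_of_pairing`**: `J s = c·v′`, `‖J‖ ≤ 1`, `√nsq(Ds) ≤ α√nsq s` ⟹ `c·Re⟨v′,D′v′⟩ ≤ (√nsq v′ + √nsq(D′v′)·‖D′⁻¹J − JD⁻¹‖)·α·√nsq s`.

HONEST FRAMING (T4-DAG p. 1).  Elementary finite-dimensional bookkeeping ([folklore]); nothing of the lineage is discharged here; NE2 (U1a) NOT proved; spine 0/9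
unchanged; NOT infinite volume, NOT a mass gap, NOT the Clay problem, NOT summit progress.  HONEST DEPENDENCY: continuum YM on T⁴ ⇐ BetaPertH ∧ nine spine
estimates (0/9 proved); BetaPertH ⇐ (D1) ∧ (D4) ∧ CAP+tail; G-an2-4 gates asym, D1 and NE2/3/4.  No `sorry`.
-/

noncomputable section

open scoped BigOperators ComplexConjugate Matrix Matrix.Norms.L2Operator
open Finset

namespace Summit.QuantumFields.BalabanUV.T4Continuum.RegionNormPairingTools

open Literature.MathematicalPhysics.QuantumFieldTheory.Balaban1983to89.B5Prop11Plancherel (Tor fine unitVec)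
open Literature.MathematicalPhysics.QuantumFieldTheory.Balaban1983to89.B5Prop11Lower (nsq nsq_nonneg star_dotProduct_self
  norm_star_dotProduct_le)
open Literature.MathematicalPhysics.QuantumFieldTheory.Balaban1983to89.B5Action121 (GradOp GradOp_mulVec sdiff_mulVec star_mulVec_dotProduct)
open Literature.MathematicalPhysics.QuantumFieldTheory.Balaban1983to89.B5Block118 (QvOp)
open Summit.QuantumFields.BalabanUV.T4Continuum
open Summit.QuantumFields.BalabanUV.T4Continuum.SubtypeCompression (ext ext_apply_of ext_apply_of_not nsq_ext)
open Summit.QuantumFields.BalabanUV.T4Continuum.ScalarBlockPoincare (nsq_smul)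
open Summit.QuantumFields.BalabanUV.T4Continuum.BalabanBlockPoincare (nsq_mulVec_le_rect)
open Summit.QuantumFields.BalabanUV.T4Continuum.CovariantBlockAveraging (opNorm_QvOp_le)
open Summit.QuantumFields.BalabanUV.T4Continuum.RegionGaugeProjection (gramK gaugeR opNorm_gaugeR_le)
open Summit.QuantumFields.BalabanUV.T4Continuum.RegionScalarCompression (QOm GOm GOm_isHermitian isUnit_det_gramK_region)
open Summit.QuantumFields.BalabanUV.T4Continuum.RegionGaugeFixedVector (starReg gradR avgR)
open Summit.QuantumFields.BalabanUV.T4Continuum.RegionGaugeFixedVectorFlat (avgR_mulVec)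
open Summit.QuantumFields.BalabanUV.T4Continuum.RegionGaugeFixedVectorTop (avgR_conjTranspose_mulVec gradR_mulVec)
open Summit.QuantumFields.BalabanUV.T4Continuum.DirichletDirectionalBesov (sqrt_nsq_smul)
open Summit.QuantumFields.BalabanUV.Beta.GAN24.DirichletBoxTrace (blockReg)

variable {d : ℕ} (n : ℕ) [NeZero n] (M : Fin d → ℕ) [hM : ∀ μ, NeZero (M μ)]

/-! ## §1 Norm bounds: the region gradient, the averaging and its adjoint -/

section Norms

variable (S : Tor M → Prop) [DecidablePred S]

/-- restricting a field to a subtype does not increase `nsq`. [folklore] -/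
theorem nsq_restrict_le' {m : Type*} [Fintype m] (p : m → Prop) [DecidablePred p] (u : m → ℂ) :
    nsq (fun a : {a // p a} => u a) ≤ nsq u := by
  unfold nsq
  rw [← Fintype.sum_subtype_add_sum_subtype p (fun i => ‖u i‖ ^ 2)]
  have h2 : 0 ≤ ∑ i : {i // ¬ p i}, ‖u i‖ ^ 2 := Finset.sum_nonneg fun i _ => sq_nonneg _
  linarith

/-- `‖∂g‖² ≤ 4d·n²·‖g‖²` for the torus gradient. [folklore] -/
theorem nsq_GradOp_mulVec_le (g : Tor (fine n M) → ℂ) :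
    nsq (GradOp (fine n M) (n : ℂ) *ᵥ g) ≤ 4 * d * (n : ℝ) ^ 2 * nsq g := by
  unfold nsq
  rw [Fintype.sum_prod_type, Finset.sum_comm]
  have hν : ∀ ν : Fin d, ∑ x : Tor (fine n M), ‖(GradOp (fine n M) (n : ℂ) *ᵥ g) (x, ν)‖ ^ 2 ≤ 4 * (n : ℝ) ^ 2 * ∑ x, ‖g x‖ ^ 2 := by
    intro ν
    have e : ∀ x : Tor (fine n M), ‖(GradOp (fine n M) (n : ℂ) *ᵥ g) (x, ν)‖ ^ 2
        ≤ (n : ℝ) ^ 2 * (2 * ‖g (x + unitVec (fine n M) ν)‖ ^ 2 + 2 * ‖g x‖ ^ 2) := by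
      intro x
      rw [GradOp_mulVec, sdiff_mulVec, norm_mul, Complex.norm_natCast, mul_pow]
      refine mul_le_mul_of_nonneg_left ?_ (sq_nonneg _)
      have h := pow_le_pow_left₀ (norm_nonneg _) (norm_sub_le (g (x + unitVec (fine n M) ν)) (g x)) 2
      nlinarith [h, sq_nonneg (‖g (x + unitVec (fine n M) ν)‖ - ‖g x‖)]
    refine (Finset.sum_le_sum fun x _ => e x).trans ?_
    rw [← Finset.mul_sum, Finset.sum_add_distrib, ← Finset.mul_sum, ← Finset.mul_sum,
      Fintype.sum_equiv (Equiv.addRight (unitVec (fine n M) ν)) (fun x => ‖g (x + unitVec (fine n M) ν)‖ ^ 2) (fun x => ‖g x‖ ^ 2)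
        (fun x => rfl)]
    ring_nf
    exact le_rfl
  calc ∑ ν : Fin d, ∑ x : Tor (fine n M), ‖(GradOp (fine n M) (n : ℂ) *ᵥ g) (x, ν)‖ ^ 2
      ≤ ∑ _ν : Fin d, 4 * (n : ℝ) ^ 2 * ∑ x, ‖g x‖ ^ 2 := Finset.sum_le_sum fun ν _ => hν ν
    _ = 4 * d * (n : ℝ) ^ 2 * ∑ x, ‖g x‖ ^ 2 := by rw [Finset.sum_const, Finset.card_univ, Fintype.card_fin, nsmul_eq_mul]; ring

/-- **`‖gradR f‖² ≤ 4d·n²·‖f‖²`** for the region gradient (any region). [folklore] -/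
theorem nsq_gradR_le (f : {x // blockReg n M S x} → ℂ) : nsq (gradR n M S *ᵥ f) ≤ 4 * d * (n : ℝ) ^ 2 * nsq f := by
  rw [gradR_mulVec]
  refine (nsq_restrict_le' (starReg n M S) _).trans ?_
  rw [← nsq_ext (blockReg n M S) f]
  exact nsq_GradOp_mulVec_le n M _

/-- `‖avgR A‖² ≤ n^{−d}·‖A‖²` (any region). [folklore] -/
theorem nsq_avgR_le (A : {b // starReg n M S b} → ℂ) : nsq (avgR n M S *ᵥ A) ≤ ((n : ℝ) ^ d)⁻¹ * nsq A := by
  have hnd : (0 : ℝ) < (n : ℝ) ^ d := pow_pos (by exact_mod_cast Nat.pos_of_ne_zero (NeZero.ne n)) d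
  have hQ : ‖QvOp n M‖ ^ 2 ≤ ((n : ℝ) ^ d)⁻¹ := by
    calc ‖QvOp n M‖ ^ 2 ≤ ((Real.sqrt ((n : ℝ) ^ d))⁻¹) ^ 2 := pow_le_pow_left₀ (norm_nonneg _) (opNorm_QvOp_le n M) 2
      _ = ((n : ℝ) ^ d)⁻¹ := by rw [inv_pow, Real.sq_sqrt hnd.le]
  rw [avgR_mulVec]
  calc nsq (QvOp n M *ᵥ ext (starReg n M S) A) ≤ ‖QvOp n M‖ ^ 2 * nsq (ext (starReg n M S) A) := nsq_mulVec_le_rect _ _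
    _ ≤ ((n : ℝ) ^ d)⁻¹ * nsq A := by rw [nsq_ext]; exact mul_le_mul_of_nonneg_right hQ (nsq_nonneg _)

/-- `‖avgRᴴ μ‖² ≤ n^{−d}·‖μ‖²` (any region). [folklore] -/
theorem nsq_avgR_conjTranspose_le (μ : Tor M × Fin d → ℂ) : nsq ((avgR n M S)ᴴ *ᵥ μ) ≤ ((n : ℝ) ^ d)⁻¹ * nsq μ := by
  have hnd : (0 : ℝ) < (n : ℝ) ^ d := pow_pos (by exact_mod_cast Nat.pos_of_ne_zero (NeZero.ne n)) d
  have hQ : ‖(QvOp n M)ᴴ‖ ^ 2 ≤ ((n : ℝ) ^ d)⁻¹ := by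
    rw [Matrix.l2_opNorm_conjTranspose]
    calc ‖QvOp n M‖ ^ 2 ≤ ((Real.sqrt ((n : ℝ) ^ d))⁻¹) ^ 2 := pow_le_pow_left₀ (norm_nonneg _) (opNorm_QvOp_le n M) 2
      _ = ((n : ℝ) ^ d)⁻¹ := by rw [inv_pow, Real.sq_sqrt hnd.le]
  rw [avgR_conjTranspose_mulVec]
  calc nsq (fun b : {b // starReg n M S b} => ((QvOp n M)ᴴ *ᵥ μ) b) ≤ nsq ((QvOp n M)ᴴ *ᵥ μ) := nsq_restrict_le' _ _
    _ ≤ ‖(QvOp n M)ᴴ‖ ^ 2 * nsq μ := nsq_mulVec_le_rect _ _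
    _ ≤ ((n : ℝ) ^ d)⁻¹ * nsq μ := mul_le_mul_of_nonneg_right hQ (nsq_nonneg _)

/-- `‖a n^d·avgRᴴavgR A‖ ≤ a·‖A‖` in `√nsq` form (`0 ≤ a`). [folklore] -/
theorem sqrt_nsq_mass_le {a : ℝ} (ha : 0 ≤ a) (A : {b // starReg n M S b} → ℂ) :
    Real.sqrt (nsq ((((a * (n : ℝ) ^ d : ℝ)) : ℂ) • ((avgR n M S)ᴴ *ᵥ (avgR n M S *ᵥ A)))) ≤ a * Real.sqrt (nsq A) := by
  have hnd : (0 : ℝ) < (n : ℝ) ^ d := pow_pos (by exact_mod_cast Nat.pos_of_ne_zero (NeZero.ne n)) d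
  have h1 : nsq ((avgR n M S)ᴴ *ᵥ (avgR n M S *ᵥ A)) ≤ (((n : ℝ) ^ d)⁻¹) ^ 2 * nsq A := by
    calc _ ≤ ((n : ℝ) ^ d)⁻¹ * nsq (avgR n M S *ᵥ A) := nsq_avgR_conjTranspose_le n M S _
      _ ≤ ((n : ℝ) ^ d)⁻¹ * (((n : ℝ) ^ d)⁻¹ * nsq A) := mul_le_mul_of_nonneg_left (nsq_avgR_le n M S A) (inv_nonneg.mpr hnd.le)
      _ = (((n : ℝ) ^ d)⁻¹) ^ 2 * nsq A := by ring
  rw [sqrt_nsq_smul, Complex.norm_real, Real.norm_of_nonneg (mul_nonneg ha hnd.le)]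
  have h2 : Real.sqrt (nsq ((avgR n M S)ᴴ *ᵥ (avgR n M S *ᵥ A))) ≤ ((n : ℝ) ^ d)⁻¹ * Real.sqrt (nsq A) := by
    rw [← Real.sqrt_sq (inv_nonneg.mpr hnd.le), ← Real.sqrt_mul (sq_nonneg _)]
    exact Real.sqrt_le_sqrt h1
  calc a * (n : ℝ) ^ d * Real.sqrt (nsq ((avgR n M S)ᴴ *ᵥ (avgR n M S *ᵥ A)))
      ≤ a * (n : ℝ) ^ d * (((n : ℝ) ^ d)⁻¹ * Real.sqrt (nsq A)) := mul_le_mul_of_nonneg_left h2 (mul_nonneg ha hnd.le)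
    _ = a * Real.sqrt (nsq A) := by rw [← mul_assoc, mul_assoc a, mul_inv_cancel₀ hnd.ne', mul_one]

/-- `‖gradR (R(Ω₀) u)‖ ≤ 2√d·n·‖u‖` in `√nsq` form. [folklore] -/
theorem sqrt_nsq_gradR_gaugeR_le (a' : ℝ) (ha' : 0 < a') (u : {x // blockReg n M S x} → ℂ) :
    Real.sqrt (nsq (gradR n M S *ᵥ (gaugeR (GOm n M a' S) (QOm n M S) *ᵥ u))) ≤ 2 * Real.sqrt d * n * Real.sqrt (nsq u) := by
  set w := gaugeR (GOm n M a' S) (QOm n M S) *ᵥ u with hw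
  have hR : nsq w ≤ nsq u := by
    calc nsq w ≤ ‖gaugeR (GOm n M a' S) (QOm n M S)‖ ^ 2 * nsq u := nsq_mulVec_le_rect _ _
      _ ≤ 1 * nsq u := by
          refine mul_le_mul_of_nonneg_right ?_ (nsq_nonneg _)
          exact pow_le_one₀ (norm_nonneg _) (opNorm_gaugeR_le _ _ (GOm_isHermitian n M a' S) (isUnit_det_gramK_region n M a' S ha'))
      _ = nsq u := one_mul _
  have h1 : nsq (gradR n M S *ᵥ w) ≤ (2 * Real.sqrt d * n) ^ 2 * nsq u := by
    calc nsq (gradR n M S *ᵥ w) ≤ 4 * d * (n : ℝ) ^ 2 * nsq w := nsq_gradR_le n M S w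
      _ ≤ 4 * d * (n : ℝ) ^ 2 * nsq u := mul_le_mul_of_nonneg_left hR (by positivity)
      _ = (2 * Real.sqrt d * n) ^ 2 * nsq u := by rw [mul_pow, mul_pow, Real.sq_sqrt (Nat.cast_nonneg d)]; ring
  calc Real.sqrt (nsq (gradR n M S *ᵥ w)) ≤ Real.sqrt ((2 * Real.sqrt d * n) ^ 2 * nsq u) := Real.sqrt_le_sqrt h1
    _ = 2 * Real.sqrt d * n * Real.sqrt (nsq u) := by rw [Real.sqrt_mul (sq_nonneg _), Real.sqrt_sq (by positivity)]

end Norms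

/-! ## §2 The pairing identity and the abstract inequality -/

section Pairing

variable {m m' : Type*} [Fintype m] [DecidableEq m] [Fintype m'] [DecidableEq m']

/-- `√nsq (X v) ≤ ‖X‖·√nsq v`. [folklore] -/
theorem sqrt_nsq_mulVec_le (X : Matrix m' m ℂ) (v : m → ℂ) : Real.sqrt (nsq (X *ᵥ v)) ≤ ‖X‖ * Real.sqrt (nsq v) := by
  rw [← Real.sqrt_sq (norm_nonneg X), ← Real.sqrt_mul (sq_nonneg _)]
  exact Real.sqrt_le_sqrt (nsq_mulVec_le_rect X v)

/-- **THE PAIRING IDENTITY**: for Hermitian `D′` with `D′·D′⁻¹ = 1`, `D` with `D⁻¹·D = 1`, any `J`, `s`: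
`⟨D′v′, (D′⁻¹J − JD⁻¹)(Ds)⟩ = ⟨v′, J(Ds)⟩ − ⟨D′v′, Js⟩`. [folklore] -/
theorem pairing_identity {D : Matrix m m ℂ} {D' : Matrix m' m' ℂ} (hD'h : D'.IsHermitian) (hD : IsUnit D.det) (hD' : IsUnit D'.det)
    (J : Matrix m' m ℂ) (s : m → ℂ) (v' : m' → ℂ) :
    star (D' *ᵥ v') ⬝ᵥ ((D'⁻¹ * J - J * D⁻¹) *ᵥ (D *ᵥ s)) = star v' ⬝ᵥ (J *ᵥ (D *ᵥ s)) - star (D' *ᵥ v') ⬝ᵥ (J *ᵥ s) := by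
  have e0 : D⁻¹ *ᵥ (D *ᵥ s) = s := by rw [Matrix.mulVec_mulVec, Matrix.nonsing_inv_mul _ hD, Matrix.one_mulVec]
  have e1 : (D'⁻¹ * J - J * D⁻¹) *ᵥ (D *ᵥ s) = D'⁻¹ *ᵥ (J *ᵥ (D *ᵥ s)) - J *ᵥ s := by
    rw [Matrix.sub_mulVec, ← Matrix.mulVec_mulVec, ← Matrix.mulVec_mulVec, e0]
  have e2 : ∀ w : m' → ℂ, star (D' *ᵥ v') ⬝ᵥ (D'⁻¹ *ᵥ w) = star v' ⬝ᵥ w := by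
    intro w
    rw [star_mulVec_dotProduct, hD'h.eq, Matrix.mulVec_mulVec, Matrix.mul_nonsing_inv _ hD', Matrix.one_mulVec]
  rw [e1, dotProduct_sub, e2]

/-- **THE ABSTRACT INEQUALITY**: if moreover `J s = c·v′` (`c` real), `‖J‖ ≤ 1` and `√nsq (Ds) ≤ α·√nsq s`, then
`c·Re⟨v′, D′v′⟩ ≤ (√nsq v′ + √nsq (D′v′)·‖D′⁻¹J − JD⁻¹‖)·α·√nsq s`. [folklore] -/
theorem energy_le_of_pairing {D : Matrix m m ℂ} {D' : Matrix m' m' ℂ} (hD'h : D'.IsHermitian) (hD : IsUnit D.det) (hD' : IsUnit D'.det)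
    {J : Matrix m' m ℂ} (hJ : ‖J‖ ≤ 1) {s : m → ℂ} {v' : m' → ℂ} {c α : ℝ} (hs : J *ᵥ s = (c : ℂ) • v')
    (hDs : Real.sqrt (nsq (D *ᵥ s)) ≤ α * Real.sqrt (nsq s)) :
    c * (star v' ⬝ᵥ (D' *ᵥ v')).re
      ≤ (Real.sqrt (nsq v') + Real.sqrt (nsq (D' *ᵥ v')) * ‖D'⁻¹ * J - J * D⁻¹‖) * (α * Real.sqrt (nsq s)) := by
  set T := D'⁻¹ * J - J * D⁻¹ with hT
  have key := pairing_identity hD'h hD hD' J s v'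
  rw [hs, dotProduct_smul, smul_eq_mul] at key
  -- `⟨D′v′, v′⟩ = ⟨v′, D′v′⟩`
  have hsym : star (D' *ᵥ v') ⬝ᵥ v' = star v' ⬝ᵥ (D' *ᵥ v') := by rw [star_mulVec_dotProduct, hD'h.eq]
  rw [hsym] at key
  -- real parts
  have hre : c * (star v' ⬝ᵥ (D' *ᵥ v')).re
      = (star v' ⬝ᵥ (J *ᵥ (D *ᵥ s))).re - (star (D' *ᵥ v') ⬝ᵥ (T *ᵥ (D *ᵥ s))).re := by
    have h := congrArg Complex.re key
    rw [Complex.sub_re, Complex.re_ofReal_mul] at h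
    linarith
  rw [hre]
  have h1 : (star v' ⬝ᵥ (J *ᵥ (D *ᵥ s))).re ≤ Real.sqrt (nsq v') * (α * Real.sqrt (nsq s)) := by
    refine (Complex.re_le_norm _).trans ((norm_star_dotProduct_le _ _).trans ?_)
    refine mul_le_mul_of_nonneg_left ?_ (Real.sqrt_nonneg _)
    calc Real.sqrt (nsq (J *ᵥ (D *ᵥ s))) ≤ ‖J‖ * Real.sqrt (nsq (D *ᵥ s)) := sqrt_nsq_mulVec_le J _
      _ ≤ 1 * (α * Real.sqrt (nsq s)) := mul_le_mul hJ hDs (Real.sqrt_nonneg _) zero_le_one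
      _ = α * Real.sqrt (nsq s) := one_mul _
  have h2 : -(star (D' *ᵥ v') ⬝ᵥ (T *ᵥ (D *ᵥ s))).re ≤ Real.sqrt (nsq (D' *ᵥ v')) * ‖T‖ * (α * Real.sqrt (nsq s)) := by
    refine (neg_le_abs _).trans ((Complex.abs_re_le_norm _).trans ((norm_star_dotProduct_le _ _).trans ?_))
    rw [mul_assoc]
    refine mul_le_mul_of_nonneg_left ?_ (Real.sqrt_nonneg _)
    calc Real.sqrt (nsq (T *ᵥ (D *ᵥ s))) ≤ ‖T‖ * Real.sqrt (nsq (D *ᵥ s)) := sqrt_nsq_mulVec_le T _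
      _ ≤ ‖T‖ * (α * Real.sqrt (nsq s)) := mul_le_mul_of_nonneg_left hDs (norm_nonneg _)
  nlinarith [h1, h2]

end Pairing


end Summit.QuantumFields.BalabanUV.T4Continuum.RegionNormPairingTools

end
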